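import Summits.QuantumFields.YangMills.Theorems.BalabanUVNodesN11OperandRowAtHistoryOfTermRows
import Summits.QuantumFields.YangMills.Theorems.BalabanUVNodesN11RePinnedOldBranchMeasurable

/-!
# DAG node N11 — THE OLD-BRANCH (O3′) THEOREM IN `PresentChildObligations`' LETTERS (the GRAFT `graftAboveB k (t s′.init) u`) AND AT THE RE-PINNED PARAMETER `rePinH θ`, where
# the four residual-measurability rows are THEOREMS too: the (O3′) DISJUNCTION from `θ.Provisos₁₃CoPH`, the level-`k` form, dag-n11-w3's term rows and the chart-side data ONLY

HEADER — WORK-UNIT METADATA.  Cell `pub-ymgap`, YM-PLAN Track A (HUMAN RULING D-0062 ∕ D-0149), width seat `pub-ymgap-dag-n11-w2` (g4; WIDTH SEAT 2∕4 on N11 [B14]),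
route `BalabanUVNodes`; this seat's jail key is K1⁷ `stmt-QuantumFields-20542` (`--kind proof --supports 20542 --as helper`, count-neutral); the K1 face of record since
KEY MAP v2 is K1⁹ `StabilityBRunRowsAtRecordR13SepCoPHV` = stmt-QuantumFields-27364 (MIS-KEY ∕ VALID rule R463 (4)(a): lineage BY NAME).  [III] = [Balaban1988Convergent].
Sequel of this seat's `…OperandRowAtHistoryOfTermRows` (§2 `termRowsAt_graftAboveB_all`; §3 the old-branch (O3′) theorem `_of_provisos_of_termRows` — displayed: `θ.Provisos₁₃CoPH`,
`hform`, FOUR residual-measurability rows, two `TermRowsAt` families, the chart-side data), over dag-n11-d's `…RePinnedParamDefs` (`rePinH θ` — `θ` with its history-indexed residual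
𝐓-weight slot replaced by the certificate family `ZhPinOfRecord₁₃`; `provisos₁₃CoPH_rePinH`, `zhAt_rePinH`, `rzAt_rePinH`, `antecedent_rePinH`, `exists_rePinH_of_exists`) and
`…RePinnedOldBranchMeasurable` (§2: `measurable_zhAt_ζ0_rePinH_of_provisos`, `measurable_zhAt_quad_rePinH` — at `rePinH θ` the residual serving ANY history has measurable
`ζ0_j(Y)` ∕ `quad_j(Λ′)`, from `θ.Provisos₁₃CoPH`), and dag-n11-e's `…Sect3SupplySpliceOwnBoundary` (`graftAboveB`).  Bus: CLAIM-6 of g4.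

WHY THIS FILE.  (1) `PresentChildObligations θ p k t tnew EkN s′` states (O3′) for the GRAFT `graftAboveB k (t s′.init) (tnew s′)`: §1 reads its two operand rows from dag-n11-w3's term
rows of the OLD value `t s′.init` (levels `1 … k`) and of the RESPONSE `u = tnew s′` (levels `k`, `k+1`) via `termRowsAt_graftAboveB_all`.  (2) The re-pinned parameter `rePinH θ` is
where dag-n11-d's no-expansion lane serves its 𝐓-step (`…NoExpansionTStepAtRePinH`) and to which the K1 antecedent moves (`antecedent_rePinH`); there the four residual-measurability
rows are NOT rows (the certificate family's `ζ0` is built from `χ_j` and def-T's resummed step weights, measurable by the core rows `measChi` ∕ `tstep.measW`; its `quad` is `0`).  So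
AT `rePinH θ` the (O3′) DISJUNCTION at a 𝐓-present child follows from `θ.Provisos₁₃CoPH F N`, Theorem 1's level-`k` form (at `rePinH θ`), the term rows, and the chart-side data
`Fᵢ₀` ∕ `hFm₀` ∕ `hin₀` ∕ `hinner₀` — NOTHING ELSE (§2 for any `(t′, E′)`, §3 for the graft).

WHAT THIS FILE PROVES (0 `sorry`, 0 `def`, standard axioms).
§1 ★★★★★★ `O3_graft_of_provisos_of_termRows` (generic `θ`: the (O3′) disjunction for `t′ := graftAboveB k (t s′.init) u` from `θ.Provisos₁₃CoPH`, `hform`, the four residual rows,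
`TermRowsAt θ p (t s′.init) j` (`1 ≤ j ≤ k`), `TermRowsAt θ p u j` (`k ≤ j ≤ k+1`), and the chart-side data).
§2 ★★★★★★ `slotsTOfRecord₁₃H_succ_O3_of_hasSect2FormAtZS_of_oldBranchInnerSum_rePinH_of_termRows` (`…OperandRowAtHistoryOfTermRows` §3 AT `rePinH θ`: the four residual rows GONE).
§3 ★★★★★★ `O3_graft_rePinH_of_termRows` (§1 AT `rePinH θ`: residual rows GONE).

HONEST FRAMING.  Helper lane, count-neutral; ONE composition each, BY NAME; `TermRowsAt`, `hform` and every chart-side hypothesis DISPLAYED — `hinner₀` is where [I] §2 ∕ [III] §3 ∕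
Thm 2 live, NOT proved here; NO chart of Bałaban's, NO Jacobian, NO Gaussian integration asserted; (B4) ∕ (S-α) ∕ (O3′) NOT closed; N11 NOT discharged; K1⁹ NOT closed, no registered
stub touched; counts unmoved (typed 28∕28 · discharged 5∕27 · A 5∕28).  One finite `𝕋⁴_{L^K}` programme at fixed `ε = L^{−K}`; R4 closes only the conditional finite-𝕋⁴ rung
`BalabanLadder.UV` — NOT ℝ⁴, NOT OS, NOT a mass gap, NOT Clay.  No `sorry`, `axiom`, `def`, `instance`, `notation`.  Sources (SHAPE ∕ bookkeeping only): [III] (2.18) p.257,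
(2.20)–(2.23) p.258, (2.40)–(2.41) p.261, (3.1) p.264, (3.2)–(3.9) pp.265–266, (3.16)–(3.25) pp.268–270, §3 p.279, Thm 1 p.262, Thm 2 p.263; [Balaban1989LargeFieldI] (0.2)–(0.3) p.176.
-/
noncomputable section

open MeasureTheory ProbabilityTheory
open scoped ENNReal NNReal BigOperators Matrix.Norms.L2Operator

namespace Summit.QuantumFields.YangMills.Theorems.BalabanUVNodesN11TStepOldBranchInnerSumAtRePinH

open Literature.MathematicalPhysics.QuantumFieldTheory.Balaban1983to89
open Literature.MathematicalPhysics.QuantumFieldTheory.Balaban1983to89.T4AveragingDisintegration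
open BalabanUVNodesN11OperandRowAtHistoryOfTermRows (slotsTOfRecord₁₃H_succ_O3_of_hasSect2FormAtZS_of_oldBranchInnerSum_of_provisos_of_termRows termRowsAt_graftAboveB_all)
open BalabanUVNodesN11Sect3SupplySpliceOwnBoundary (graftAboveB)
open BalabanUVNodesN11Sect3SupplyChainTermRows (TermRowsAt)
open BalabanUVNodesN11RePinnedParamDefs (rePinH provisos₁₃CoPH_rePinH)
open BalabanUVNodesN11RePinnedOldBranchMeasurable (measurable_zhAt_ζ0_rePinH_of_provisos measurable_zhAt_quad_rePinH)
open Node00 hiding SU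
open Node00.Tk T4Continuum B14.Eq218Concrete
open B10Eq42TorusConstraint (bondsIn)

variable {F : T4Family} {N : ℕ} [NeZero N]

/-! ## §1  In `PresentChildObligations`' letters: the (O3′) disjunction for the GRAFT, operand rows from the term rows of the old value and of the response -/

/-- ★★★★★★ **THE (O3′) DISJUNCTION FOR THE GRAFT `graftAboveB k (t s′.init) u`** (the witness of `PresentChildObligations`' last conjunct, `u := tnew s′`, `E′ := EkN s′`), generic
`θ`: `…OperandRowAtHistoryOfTermRows` §3 with the new value `t′ := graftAboveB k (t s′.init) u`, whose term rows at the levels `1 … k+1` come from those of `t s′.init` (levels `1 … k`)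
and of `u` (levels `k`, `k+1`) by `termRowsAt_graftAboveB_all`.  Displayed: `h : θ.Provisos₁₃CoPH F N`, `hform`, the four residual-measurability rows, the two term-row families, the
chart-side data (`hinner₀` stated for the graft's operand). [cite: Balaban1988Convergent, Thm 2 p.263, §3 p.279, (3.24)–(3.25) p.270, (2.40)–(2.41) p.261, (2.18) p.257, (2.20)–(2.23) p.258] -/
theorem O3_graft_of_provisos_of_termRows (θ : Stage13HParams F N) (h : θ.Provisos₁₃CoPH F N)
    (p : B12.RunParams) {k : ℕ} (hkK : k < p.K)
    {hdec : DecidableEq (PBond (F.P p.K) k)} {hdec' : DecidableEq (PBond (F.P p.K) (k + 1))} (hk : k + 1 ≤ (F.P p.K).m + (F.P p.K).K)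
    (s' : SeqOfRecord F θ.ν θ.τ9.M (gOfRecord₁₃ F N θ.toStage13Params p) p.K (k + 1))
    {law : SeqOfRecord F θ.ν θ.τ9.M (gOfRecord₁₃ F N θ.toStage13Params p) p.K k → Sect2.TermValues (F.P p.K) (MatA N) (FluctV N) θ.τ9.M → Prop}
    {t : SeqOfRecord F θ.ν θ.τ9.M (gOfRecord₁₃ F N θ.toStage13Params p) p.K k → Sect2.TermValues (F.P p.K) (MatA N) (FluctV N) θ.τ9.M}
    {Ek : SeqOfRecord F θ.ν θ.τ9.M (gOfRecord₁₃ F N θ.toStage13Params p) p.K k → ℝ}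
    (hform : HasSect2FormAtZS F N (FluctV N) p.K (settingOfRecord₁₃ F N θ.toStage13Params p) k (θ.rzAt p) (WtOfRecord₁₃H F N θ p)
      (UbgOfRecord₁₃CoP F N θ.toStage13Params p k) law
      (slotsOfRecord F N θ.ν θ.τ9 (EOfRecord₁₃ F N θ.toStage13Params) (wOfRecord₉ F N θ.toStage9Params) θ.ppSel p (gOfRecord₁₃ F N θ.toStage13Params p) k) t Ek)
    (u : Sect2.TermValues (F.P p.K) (MatA N) (FluctV N) θ.τ9.M) (E' : ℝ)
    -- measurability of the residuals serving `init s′` and `s′` (dag-n11-e's `ResidualRowsAt` shapes) …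
    (hζ0m : ∀ j Y, Measurable ((θ.zhAt p s'.init).ζ0 j Y)) (hqm : ∀ j Λ', Measurable ((θ.zhAt p s'.init).quad j Λ'))
    (hζm : ∀ j Y, Measurable ((θ.zhAt p s').ζ0 j Y)) (hqm' : ∀ j Λ', Measurable ((θ.zhAt p s').quad j Λ'))
    -- … and dag-n11-w3's TERM ROWS of the old witness value at the levels `1 … k` and of the RESPONSE `u` at the levels `k`, `k+1`
    (htrows₀ : ∀ j, 1 ≤ j → j ≤ k → TermRowsAt θ p (t s'.init) j) (hnew : ∀ j, k ≤ j → j ≤ k + 1 → TermRowsAt θ p u j)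
    (Fᵢ₀ : (ℕ → Set (Site (F.P p.K) 0)) → (↥(Set.toFinite (bondsIn k (s'.Ω (k + 1))ᶜ)).toFinset → SU N) ×
        ({c : PBond (F.P p.K) (k + 1) // c ∉ (Set.toFinite (bondsIn (k + 1) (s'.Ω (k + 1))ᶜ)).toFinset} → SU N) → ℝ)
    (hFm₀ : ∀ S₀ ∈ admSOfRecord F θ.ν θ.τ9.M (gOfRecord₁₃ F N θ.toStage13Params p) p.K k s'.init, Measurable (Fᵢ₀ S₀))
    (hin₀ : ∀ S₀ ∈ admSOfRecord F θ.ν θ.τ9.M (gOfRecord₁₃ F N θ.toStage13Params p) p.K k s'.init, kernelTransport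
        ((Measure.pi fun _ : ↥(Set.toFinite (bondsIn k (s'.Ω (k + 1))ᶜ)).toFinset => (HaarData.haar : Measure (SU N))).prod
          (Measure.pi fun _ : {b : PBond (F.P p.K) k // b ∉ (Set.toFinite (bondsIn k (s'.Ω (k + 1))ᶜ)).toFinset} => (HaarData.haar : Measure (SU N))))
        ((Measure.pi fun _ : ↥(Set.toFinite (bondsIn k (s'.Ω (k + 1))ᶜ)).toFinset => (HaarData.haar : Measure (SU N))).prod
          (Measure.pi fun _ : {c : PBond (F.P p.K) (k + 1) // c ∉ (Set.toFinite (bondsIn (k + 1) (s'.Ω (k + 1))ᶜ)).toFinset} =>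
            (HaarData.haar : Measure (SU N))))
        (fun q => (q.1, fun c : {c : PBond (F.P p.K) (k + 1) // c ∉ (Set.toFinite (bondsIn (k + 1) (s'.Ω (k + 1))ᶜ)).toFinset} =>
          (avOfRecord F N p.K k).avg
            ((MeasurableEquiv.piEquivPiSubtypeProd (fun _ : PBond (F.P p.K) k => SU N)
              (· ∈ (Set.toFinite (bondsIn k (s'.Ω (k + 1))ᶜ)).toFinset)).symm q) c))
        ((fun U => wOfRecord₉ F N θ.toStage9Params p (gOfRecord₁₃ F N θ.toStage13Params p) k s' U ((avOfRecord F N p.K k).avg U) *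
            (chiSeqOfRecord F N θ.ν θ.τ9.M (gOfRecord₁₃ F N θ.toStage13Params p) p.K k s'.init U *
              tkBranchOfRecord F N (FluctV N) θ.ν θ.τ9.M (gOfRecord₁₃ F N θ.toStage13Params p) p.K (WtOfRecord₁₃H F N θ p s'.init) s'.init S₀ k
                (fun ω => (sect2Operand F N (FluctV N) p.K (settingOfRecord₁₃ F N θ.toStage13Params p) (θ.rzAt p s'.init) s'.init (t s'.init) (Ek s'.init)
            (UbgOfRecord₁₃CoP F N θ.toStage13Params p k s'.init)) (S₀, fun j => (ω j).2) (fun j => (ω j).1)) (baseCfg k U))) ∘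
          ⇑(MeasurableEquiv.piEquivPiSubtypeProd (fun _ : PBond (F.P p.K) k => SU N)
            (· ∈ (Set.toFinite (bondsIn k (s'.Ω (k + 1))ᶜ)).toFinset)).symm)
      =ᵐ[((Measure.pi fun _ : ↥(Set.toFinite (bondsIn k (s'.Ω (k + 1))ᶜ)).toFinset => (HaarData.haar : Measure (SU N))).prod
          (Measure.pi fun _ : {c : PBond (F.P p.K) (k + 1) // c ∉ (Set.toFinite (bondsIn (k + 1) (s'.Ω (k + 1))ᶜ)).toFinset} =>
            (HaarData.haar : Measure (SU N))))] Fᵢ₀ S₀)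
    (hinner₀ : ∀ᵐ q ∂((Measure.pi fun _ : ↥(Set.toFinite (bondsIn (k + 1) (s'.Ω (k + 1))ᶜ)).toFinset => (HaarData.haar : Measure (SU N))).prod
          (Measure.pi fun _ : {c : PBond (F.P p.K) (k + 1) // c ∉ (Set.toFinite (bondsIn (k + 1) (s'.Ω (k + 1))ᶜ)).toFinset} =>
            (HaarData.haar : Measure (SU N)))),
      ∀ S₀ ∈ admSOfRecord F θ.ν θ.τ9.M (gOfRecord₁₃ F N θ.toStage13Params p) p.K k s'.init, ∀ y : ↥(Set.toFinite (bondsIn k (s'.Ω (k + 1))ᶜ)).toFinset → SU N,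
        avgRestrOfRecord F N p.K k (Set.toFinite (bondsIn k (s'.Ω (k + 1))ᶜ)).toFinset (Set.toFinite (bondsIn (k + 1) (s'.Ω (k + 1))ᶜ)).toFinset y = q.1 →
        Fᵢ₀ S₀ (y, q.2) =
          ∑ Y ∈ (Set.toFinite {Y : Set (Site (F.P p.K) 0) | Y ∈ SClassOfRecord F θ.ν (gOfRecord₁₃ F N θ.toStage13Params p) p.K (k + 1) ∧ Y ⊆ s'.Ω (k + 1) ∩ (s'.Λ (k + 1))ᶜ}).toFinset,
            zetaOp (genDataOfRecord F N (FluctV N) θ.ν θ.τ9.M (gOfRecord₁₃ F N θ.toStage13Params p) p.K (WtOfRecord₁₃H F N θ p s') s' (Function.update S₀ (k + 1) Y) k).ζ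
              (aOp k (genDataOfRecord F N (FluctV N) θ.ν θ.τ9.M (gOfRecord₁₃ F N θ.toStage13Params p) p.K (WtOfRecord₁₃H F N θ p s') s' (Function.update S₀ (k + 1) Y) k).sA
                (genDataOfRecord F N (FluctV N) θ.ν θ.τ9.M (gOfRecord₁₃ F N θ.toStage13Params p) p.K (WtOfRecord₁₃H F N θ p s') s' (Function.update S₀ (k + 1) Y) k).w
                (tkBranchOfRecord F N (FluctV N) θ.ν θ.τ9.M (gOfRecord₁₃ F N θ.toStage13Params p) p.K (WtOfRecord₁₃H F N θ p s') s'.init S₀ k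
                  (fun ω => (sect2Operand F N (FluctV N) p.K (settingOfRecord₁₃ F N θ.toStage13Params p) (θ.rzAt p s') s' (graftAboveB k (t s'.init) u) E'
                  (UbgOfRecord₁₃CoP F N θ.toStage13Params p (k + 1) s')) (Function.update S₀ (k + 1) Y, fun j => (ω j).2) (fun j => (ω j).1))))
              (Function.update (baseCfg (k + 1) ((MeasurableEquiv.piEquivPiSubtypeProd (fun _ : PBond (F.P p.K) (k + 1) => SU N)
                (· ∈ (Set.toFinite (bondsIn (k + 1) (s'.Ω (k + 1))ᶜ)).toFinset)).symm q)) k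
              (Function.updateFinset ((baseCfg (V := FluctV N) (k + 1) ((MeasurableEquiv.piEquivPiSubtypeProd (fun _ : PBond (F.P p.K) (k + 1) => SU N)
                (· ∈ (Set.toFinite (bondsIn (k + 1) (s'.Ω (k + 1))ᶜ)).toFinset)).symm q)) k).1 (Set.toFinite (bondsIn k (s'.Ω (k + 1))ᶜ)).toFinset y,
                ((baseCfg (V := FluctV N) (k + 1) ((MeasurableEquiv.piEquivPiSubtypeProd (fun _ : PBond (F.P p.K) (k + 1) => SU N)
                (· ∈ (Set.toFinite (bondsIn (k + 1) (s'.Ω (k + 1))ᶜ)).toFinset)).symm q)) k).2))) :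
    slotsTOfRecord F N θ.ν θ.τ9 (EOfRecord₁₃ F N θ.toStage13Params) (wOfRecord₉ F N θ.toStage9Params) θ.ppSel p (gOfRecord₁₃ F N θ.toStage13Params p) (k + 1) s' = 0 ∨
      ∀ᵐ V' ∂fieldMeasure (F.P p.K) (k + 1) (SU N),
        chiSeqOfRecord F N θ.ν θ.τ9.M (gOfRecord₁₃ F N θ.toStage13Params p) p.K (k + 1) s' V' ≠ 0 →
          slotsTOfRecord F N θ.ν θ.τ9 (EOfRecord₁₃ F N θ.toStage13Params) (wOfRecord₉ F N θ.toStage9Params) θ.ppSel p (gOfRecord₁₃ F N θ.toStage13Params p) (k + 1) s' V' =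
            sect2Slot F N (FluctV N) p.K (settingOfRecord₁₃ F N θ.toStage13Params p) (θ.rzAt p s') (WtOfRecord₁₃H F N θ p s') s' (graftAboveB k (t s'.init) u) E'
              (UbgOfRecord₁₃CoP F N θ.toStage13Params p (k + 1) s') V' :=
  slotsTOfRecord₁₃H_succ_O3_of_hasSect2FormAtZS_of_oldBranchInnerSum_of_provisos_of_termRows θ h p hkK (hdec := hdec) (hdec' := hdec') hk s' hform
    (graftAboveB k (t s'.init) u) E' hζ0m hqm hζm hqm' htrows₀ (termRowsAt_graftAboveB_all k (t s'.init) u htrows₀ hnew) Fᵢ₀ hFm₀ hin₀ hinner₀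

/-! ## §2  At the re-pinned parameter `rePinH θ`: no residual-measurability row -/

/-- ★★★★★★ **THE (O3′) DISJUNCTION ON THE OLD-BRANCH ROAD AT THE RE-PINNED PARAMETER `rePinH θ`** — from `θ.Provisos₁₃CoPH F N`, Theorem 1's level-`k` form `hform` at `rePinH θ`
(ANY law package), dag-n11-w3's TERM ROWS of the old witness value `t s′.init` (levels `1 … k`) and of the proposed new one `t′` (levels `1 … k+1`), and the per-old-branch chart-side
data `Fᵢ₀` ∕ `hFm₀` ∕ `hin₀` ∕ `hinner₀` — NO residual-measurability row, NO operand row, NO integrability row, NO law row.  `…OperandRowAtHistoryOfTermRows` §3 at `rePinH θ` with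
`provisos₁₃CoPH_rePinH h` and dag-n11-d's `measurable_zhAt_ζ0_rePinH_of_provisos` ∕ `measurable_zhAt_quad_rePinH` at `init s′` and `s′` (`TermRowsAt (rePinH θ) p = TermRowsAt θ p` and
the ₁₃ histories ∕ numerics of `rePinH θ` are `θ`'s, by `rfl`). [cite: Balaban1988Convergent, Thm 1 p.262, Thm 2 p.263, §3 p.279, (3.1) p.264, (3.24)–(3.25) p.270; Balaban1989LargeFieldI, (0.2)–(0.3) p.176] -/
theorem slotsTOfRecord₁₃H_succ_O3_of_hasSect2FormAtZS_of_oldBranchInnerSum_rePinH_of_termRows (θ : Stage13HParams F N) (h : θ.Provisos₁₃CoPH F N)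
    (p : B12.RunParams) {k : ℕ} (hkK : k < p.K)
    {hdec : DecidableEq (PBond (F.P p.K) k)} {hdec' : DecidableEq (PBond (F.P p.K) (k + 1))} (hk : k + 1 ≤ (F.P p.K).m + (F.P p.K).K)
    (s' : SeqOfRecord F (rePinH θ).ν (rePinH θ).τ9.M (gOfRecord₁₃ F N (rePinH θ).toStage13Params p) p.K (k + 1))
    {law : SeqOfRecord F (rePinH θ).ν (rePinH θ).τ9.M (gOfRecord₁₃ F N (rePinH θ).toStage13Params p) p.K k → Sect2.TermValues (F.P p.K) (MatA N) (FluctV N) (rePinH θ).τ9.M → Prop}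
    {t : SeqOfRecord F (rePinH θ).ν (rePinH θ).τ9.M (gOfRecord₁₃ F N (rePinH θ).toStage13Params p) p.K k → Sect2.TermValues (F.P p.K) (MatA N) (FluctV N) (rePinH θ).τ9.M}
    {Ek : SeqOfRecord F (rePinH θ).ν (rePinH θ).τ9.M (gOfRecord₁₃ F N (rePinH θ).toStage13Params p) p.K k → ℝ}
    (hform : HasSect2FormAtZS F N (FluctV N) p.K (settingOfRecord₁₃ F N (rePinH θ).toStage13Params p) k ((rePinH θ).rzAt p) (WtOfRecord₁₃H F N (rePinH θ) p)
      (UbgOfRecord₁₃CoP F N (rePinH θ).toStage13Params p k) law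
      (slotsOfRecord F N (rePinH θ).ν (rePinH θ).τ9 (EOfRecord₁₃ F N (rePinH θ).toStage13Params) (wOfRecord₉ F N (rePinH θ).toStage9Params) (rePinH θ).ppSel p (gOfRecord₁₃ F N (rePinH θ).toStage13Params p) k) t Ek)
    (t' : Sect2.TermValues (F.P p.K) (MatA N) (FluctV N) (rePinH θ).τ9.M) (E' : ℝ)
    -- dag-n11-w3's TERM ROWS of the old witness value at the levels `1 … k` and of the proposed new one at the levels `1 … k+1`
    (htrows₀ : ∀ j, 1 ≤ j → j ≤ k → TermRowsAt (rePinH θ) p (t s'.init) j) (htrows : ∀ j, 1 ≤ j → j ≤ k + 1 → TermRowsAt (rePinH θ) p t' j)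
    (Fᵢ₀ : (ℕ → Set (Site (F.P p.K) 0)) → (↥(Set.toFinite (bondsIn k (s'.Ω (k + 1))ᶜ)).toFinset → SU N) ×
        ({c : PBond (F.P p.K) (k + 1) // c ∉ (Set.toFinite (bondsIn (k + 1) (s'.Ω (k + 1))ᶜ)).toFinset} → SU N) → ℝ)
    (hFm₀ : ∀ S₀ ∈ admSOfRecord F (rePinH θ).ν (rePinH θ).τ9.M (gOfRecord₁₃ F N (rePinH θ).toStage13Params p) p.K k s'.init, Measurable (Fᵢ₀ S₀))
    (hin₀ : ∀ S₀ ∈ admSOfRecord F (rePinH θ).ν (rePinH θ).τ9.M (gOfRecord₁₃ F N (rePinH θ).toStage13Params p) p.K k s'.init, kernelTransport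
        ((Measure.pi fun _ : ↥(Set.toFinite (bondsIn k (s'.Ω (k + 1))ᶜ)).toFinset => (HaarData.haar : Measure (SU N))).prod
          (Measure.pi fun _ : {b : PBond (F.P p.K) k // b ∉ (Set.toFinite (bondsIn k (s'.Ω (k + 1))ᶜ)).toFinset} => (HaarData.haar : Measure (SU N))))
        ((Measure.pi fun _ : ↥(Set.toFinite (bondsIn k (s'.Ω (k + 1))ᶜ)).toFinset => (HaarData.haar : Measure (SU N))).prod
          (Measure.pi fun _ : {c : PBond (F.P p.K) (k + 1) // c ∉ (Set.toFinite (bondsIn (k + 1) (s'.Ω (k + 1))ᶜ)).toFinset} =>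
            (HaarData.haar : Measure (SU N))))
        (fun q => (q.1, fun c : {c : PBond (F.P p.K) (k + 1) // c ∉ (Set.toFinite (bondsIn (k + 1) (s'.Ω (k + 1))ᶜ)).toFinset} =>
          (avOfRecord F N p.K k).avg
            ((MeasurableEquiv.piEquivPiSubtypeProd (fun _ : PBond (F.P p.K) k => SU N)
              (· ∈ (Set.toFinite (bondsIn k (s'.Ω (k + 1))ᶜ)).toFinset)).symm q) c))
        ((fun U => wOfRecord₉ F N (rePinH θ).toStage9Params p (gOfRecord₁₃ F N (rePinH θ).toStage13Params p) k s' U ((avOfRecord F N p.K k).avg U) *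
            (chiSeqOfRecord F N (rePinH θ).ν (rePinH θ).τ9.M (gOfRecord₁₃ F N (rePinH θ).toStage13Params p) p.K k s'.init U *
              tkBranchOfRecord F N (FluctV N) (rePinH θ).ν (rePinH θ).τ9.M (gOfRecord₁₃ F N (rePinH θ).toStage13Params p) p.K (WtOfRecord₁₃H F N (rePinH θ) p s'.init) s'.init S₀ k
                (fun ω => (sect2Operand F N (FluctV N) p.K (settingOfRecord₁₃ F N (rePinH θ).toStage13Params p) ((rePinH θ).rzAt p s'.init) s'.init (t s'.init) (Ek s'.init)
            (UbgOfRecord₁₃CoP F N (rePinH θ).toStage13Params p k s'.init)) (S₀, fun j => (ω j).2) (fun j => (ω j).1)) (baseCfg k U))) ∘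
          ⇑(MeasurableEquiv.piEquivPiSubtypeProd (fun _ : PBond (F.P p.K) k => SU N)
            (· ∈ (Set.toFinite (bondsIn k (s'.Ω (k + 1))ᶜ)).toFinset)).symm)
      =ᵐ[((Measure.pi fun _ : ↥(Set.toFinite (bondsIn k (s'.Ω (k + 1))ᶜ)).toFinset => (HaarData.haar : Measure (SU N))).prod
          (Measure.pi fun _ : {c : PBond (F.P p.K) (k + 1) // c ∉ (Set.toFinite (bondsIn (k + 1) (s'.Ω (k + 1))ᶜ)).toFinset} =>
            (HaarData.haar : Measure (SU N))))] Fᵢ₀ S₀)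
    (hinner₀ : ∀ᵐ q ∂((Measure.pi fun _ : ↥(Set.toFinite (bondsIn (k + 1) (s'.Ω (k + 1))ᶜ)).toFinset => (HaarData.haar : Measure (SU N))).prod
          (Measure.pi fun _ : {c : PBond (F.P p.K) (k + 1) // c ∉ (Set.toFinite (bondsIn (k + 1) (s'.Ω (k + 1))ᶜ)).toFinset} =>
            (HaarData.haar : Measure (SU N)))),
      ∀ S₀ ∈ admSOfRecord F (rePinH θ).ν (rePinH θ).τ9.M (gOfRecord₁₃ F N (rePinH θ).toStage13Params p) p.K k s'.init, ∀ y : ↥(Set.toFinite (bondsIn k (s'.Ω (k + 1))ᶜ)).toFinset → SU N,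
        avgRestrOfRecord F N p.K k (Set.toFinite (bondsIn k (s'.Ω (k + 1))ᶜ)).toFinset (Set.toFinite (bondsIn (k + 1) (s'.Ω (k + 1))ᶜ)).toFinset y = q.1 →
        Fᵢ₀ S₀ (y, q.2) =
          ∑ Y ∈ (Set.toFinite {Y : Set (Site (F.P p.K) 0) | Y ∈ SClassOfRecord F (rePinH θ).ν (gOfRecord₁₃ F N (rePinH θ).toStage13Params p) p.K (k + 1) ∧ Y ⊆ s'.Ω (k + 1) ∩ (s'.Λ (k + 1))ᶜ}).toFinset,
            zetaOp (genDataOfRecord F N (FluctV N) (rePinH θ).ν (rePinH θ).τ9.M (gOfRecord₁₃ F N (rePinH θ).toStage13Params p) p.K (WtOfRecord₁₃H F N (rePinH θ) p s') s' (Function.update S₀ (k + 1) Y) k).ζ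
              (aOp k (genDataOfRecord F N (FluctV N) (rePinH θ).ν (rePinH θ).τ9.M (gOfRecord₁₃ F N (rePinH θ).toStage13Params p) p.K (WtOfRecord₁₃H F N (rePinH θ) p s') s' (Function.update S₀ (k + 1) Y) k).sA
                (genDataOfRecord F N (FluctV N) (rePinH θ).ν (rePinH θ).τ9.M (gOfRecord₁₃ F N (rePinH θ).toStage13Params p) p.K (WtOfRecord₁₃H F N (rePinH θ) p s') s' (Function.update S₀ (k + 1) Y) k).w
                (tkBranchOfRecord F N (FluctV N) (rePinH θ).ν (rePinH θ).τ9.M (gOfRecord₁₃ F N (rePinH θ).toStage13Params p) p.K (WtOfRecord₁₃H F N (rePinH θ) p s') s'.init S₀ k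
                  (fun ω => (sect2Operand F N (FluctV N) p.K (settingOfRecord₁₃ F N (rePinH θ).toStage13Params p) ((rePinH θ).rzAt p s') s' t' E'
                  (UbgOfRecord₁₃CoP F N (rePinH θ).toStage13Params p (k + 1) s')) (Function.update S₀ (k + 1) Y, fun j => (ω j).2) (fun j => (ω j).1))))
              (Function.update (baseCfg (k + 1) ((MeasurableEquiv.piEquivPiSubtypeProd (fun _ : PBond (F.P p.K) (k + 1) => SU N)
                (· ∈ (Set.toFinite (bondsIn (k + 1) (s'.Ω (k + 1))ᶜ)).toFinset)).symm q)) k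
              (Function.updateFinset ((baseCfg (V := FluctV N) (k + 1) ((MeasurableEquiv.piEquivPiSubtypeProd (fun _ : PBond (F.P p.K) (k + 1) => SU N)
                (· ∈ (Set.toFinite (bondsIn (k + 1) (s'.Ω (k + 1))ᶜ)).toFinset)).symm q)) k).1 (Set.toFinite (bondsIn k (s'.Ω (k + 1))ᶜ)).toFinset y,
                ((baseCfg (V := FluctV N) (k + 1) ((MeasurableEquiv.piEquivPiSubtypeProd (fun _ : PBond (F.P p.K) (k + 1) => SU N)
                (· ∈ (Set.toFinite (bondsIn (k + 1) (s'.Ω (k + 1))ᶜ)).toFinset)).symm q)) k).2))) :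
    slotsTOfRecord F N (rePinH θ).ν (rePinH θ).τ9 (EOfRecord₁₃ F N (rePinH θ).toStage13Params) (wOfRecord₉ F N (rePinH θ).toStage9Params) (rePinH θ).ppSel p (gOfRecord₁₃ F N (rePinH θ).toStage13Params p) (k + 1) s' = 0 ∨
      ∀ᵐ V' ∂fieldMeasure (F.P p.K) (k + 1) (SU N),
        chiSeqOfRecord F N (rePinH θ).ν (rePinH θ).τ9.M (gOfRecord₁₃ F N (rePinH θ).toStage13Params p) p.K (k + 1) s' V' ≠ 0 →
          slotsTOfRecord F N (rePinH θ).ν (rePinH θ).τ9 (EOfRecord₁₃ F N (rePinH θ).toStage13Params) (wOfRecord₉ F N (rePinH θ).toStage9Params) (rePinH θ).ppSel p (gOfRecord₁₃ F N (rePinH θ).toStage13Params p) (k + 1) s' V' =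
            sect2Slot F N (FluctV N) p.K (settingOfRecord₁₃ F N (rePinH θ).toStage13Params p) ((rePinH θ).rzAt p s') (WtOfRecord₁₃H F N (rePinH θ) p s') s' t' E'
              (UbgOfRecord₁₃CoP F N (rePinH θ).toStage13Params p (k + 1) s') V' :=
  slotsTOfRecord₁₃H_succ_O3_of_hasSect2FormAtZS_of_oldBranchInnerSum_of_provisos_of_termRows (rePinH θ) (provisos₁₃CoPH_rePinH h) p hkK
    (hdec := hdec) (hdec' := hdec') hk s' hform t' E'
    (measurable_zhAt_ζ0_rePinH_of_provisos θ p h s'.init) (measurable_zhAt_quad_rePinH θ p s'.init)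
    (measurable_zhAt_ζ0_rePinH_of_provisos θ p h s') (measurable_zhAt_quad_rePinH θ p s') htrows₀ htrows Fᵢ₀ hFm₀ hin₀ hinner₀

/-! ## §3  At `rePinH θ`, in `PresentChildObligations`' letters -/

/-- ★★★★★★ **THE (O3′) DISJUNCTION FOR THE GRAFT AT `rePinH θ`** — §1 at the re-pinned parameter: from `θ.Provisos₁₃CoPH F N`, `hform` at `rePinH θ`, `TermRowsAt θ p (t s′.init) j`
(`1 ≤ j ≤ k`), `TermRowsAt θ p u j` (`k ≤ j ≤ k+1`), and the chart-side data ONLY. [cite: Balaban1988Convergent, Thm 2 p.263, §3 p.279, (3.24)–(3.25) p.270, (2.40)–(2.41) p.261; Balaban1989LargeFieldI, (0.2)–(0.3) p.176] -/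
theorem O3_graft_rePinH_of_termRows (θ : Stage13HParams F N) (h : θ.Provisos₁₃CoPH F N)
    (p : B12.RunParams) {k : ℕ} (hkK : k < p.K)
    {hdec : DecidableEq (PBond (F.P p.K) k)} {hdec' : DecidableEq (PBond (F.P p.K) (k + 1))} (hk : k + 1 ≤ (F.P p.K).m + (F.P p.K).K)
    (s' : SeqOfRecord F (rePinH θ).ν (rePinH θ).τ9.M (gOfRecord₁₃ F N (rePinH θ).toStage13Params p) p.K (k + 1))
    {law : SeqOfRecord F (rePinH θ).ν (rePinH θ).τ9.M (gOfRecord₁₃ F N (rePinH θ).toStage13Params p) p.K k → Sect2.TermValues (F.P p.K) (MatA N) (FluctV N) (rePinH θ).τ9.M → Prop}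
    {t : SeqOfRecord F (rePinH θ).ν (rePinH θ).τ9.M (gOfRecord₁₃ F N (rePinH θ).toStage13Params p) p.K k → Sect2.TermValues (F.P p.K) (MatA N) (FluctV N) (rePinH θ).τ9.M}
    {Ek : SeqOfRecord F (rePinH θ).ν (rePinH θ).τ9.M (gOfRecord₁₃ F N (rePinH θ).toStage13Params p) p.K k → ℝ}
    (hform : HasSect2FormAtZS F N (FluctV N) p.K (settingOfRecord₁₃ F N (rePinH θ).toStage13Params p) k ((rePinH θ).rzAt p) (WtOfRecord₁₃H F N (rePinH θ) p)
      (UbgOfRecord₁₃CoP F N (rePinH θ).toStage13Params p k) law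
      (slotsOfRecord F N (rePinH θ).ν (rePinH θ).τ9 (EOfRecord₁₃ F N (rePinH θ).toStage13Params) (wOfRecord₉ F N (rePinH θ).toStage9Params) (rePinH θ).ppSel p (gOfRecord₁₃ F N (rePinH θ).toStage13Params p) k) t Ek)
    (u : Sect2.TermValues (F.P p.K) (MatA N) (FluctV N) (rePinH θ).τ9.M) (E' : ℝ)
    -- dag-n11-w3's TERM ROWS of the old witness value at the levels `1 … k` and of the RESPONSE `u` at the levels `k`, `k+1`
    (htrows₀ : ∀ j, 1 ≤ j → j ≤ k → TermRowsAt (rePinH θ) p (t s'.init) j) (hnew : ∀ j, k ≤ j → j ≤ k + 1 → TermRowsAt (rePinH θ) p u j)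
    (Fᵢ₀ : (ℕ → Set (Site (F.P p.K) 0)) → (↥(Set.toFinite (bondsIn k (s'.Ω (k + 1))ᶜ)).toFinset → SU N) ×
        ({c : PBond (F.P p.K) (k + 1) // c ∉ (Set.toFinite (bondsIn (k + 1) (s'.Ω (k + 1))ᶜ)).toFinset} → SU N) → ℝ)
    (hFm₀ : ∀ S₀ ∈ admSOfRecord F (rePinH θ).ν (rePinH θ).τ9.M (gOfRecord₁₃ F N (rePinH θ).toStage13Params p) p.K k s'.init, Measurable (Fᵢ₀ S₀))
    (hin₀ : ∀ S₀ ∈ admSOfRecord F (rePinH θ).ν (rePinH θ).τ9.M (gOfRecord₁₃ F N (rePinH θ).toStage13Params p) p.K k s'.init, kernelTransport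
        ((Measure.pi fun _ : ↥(Set.toFinite (bondsIn k (s'.Ω (k + 1))ᶜ)).toFinset => (HaarData.haar : Measure (SU N))).prod
          (Measure.pi fun _ : {b : PBond (F.P p.K) k // b ∉ (Set.toFinite (bondsIn k (s'.Ω (k + 1))ᶜ)).toFinset} => (HaarData.haar : Measure (SU N))))
        ((Measure.pi fun _ : ↥(Set.toFinite (bondsIn k (s'.Ω (k + 1))ᶜ)).toFinset => (HaarData.haar : Measure (SU N))).prod
          (Measure.pi fun _ : {c : PBond (F.P p.K) (k + 1) // c ∉ (Set.toFinite (bondsIn (k + 1) (s'.Ω (k + 1))ᶜ)).toFinset} =>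
            (HaarData.haar : Measure (SU N))))
        (fun q => (q.1, fun c : {c : PBond (F.P p.K) (k + 1) // c ∉ (Set.toFinite (bondsIn (k + 1) (s'.Ω (k + 1))ᶜ)).toFinset} =>
          (avOfRecord F N p.K k).avg
            ((MeasurableEquiv.piEquivPiSubtypeProd (fun _ : PBond (F.P p.K) k => SU N)
              (· ∈ (Set.toFinite (bondsIn k (s'.Ω (k + 1))ᶜ)).toFinset)).symm q) c))
        ((fun U => wOfRecord₉ F N (rePinH θ).toStage9Params p (gOfRecord₁₃ F N (rePinH θ).toStage13Params p) k s' U ((avOfRecord F N p.K k).avg U) *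
            (chiSeqOfRecord F N (rePinH θ).ν (rePinH θ).τ9.M (gOfRecord₁₃ F N (rePinH θ).toStage13Params p) p.K k s'.init U *
              tkBranchOfRecord F N (FluctV N) (rePinH θ).ν (rePinH θ).τ9.M (gOfRecord₁₃ F N (rePinH θ).toStage13Params p) p.K (WtOfRecord₁₃H F N (rePinH θ) p s'.init) s'.init S₀ k
                (fun ω => (sect2Operand F N (FluctV N) p.K (settingOfRecord₁₃ F N (rePinH θ).toStage13Params p) ((rePinH θ).rzAt p s'.init) s'.init (t s'.init) (Ek s'.init)
            (UbgOfRecord₁₃CoP F N (rePinH θ).toStage13Params p k s'.init)) (S₀, fun j => (ω j).2) (fun j => (ω j).1)) (baseCfg k U))) ∘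
          ⇑(MeasurableEquiv.piEquivPiSubtypeProd (fun _ : PBond (F.P p.K) k => SU N)
            (· ∈ (Set.toFinite (bondsIn k (s'.Ω (k + 1))ᶜ)).toFinset)).symm)
      =ᵐ[((Measure.pi fun _ : ↥(Set.toFinite (bondsIn k (s'.Ω (k + 1))ᶜ)).toFinset => (HaarData.haar : Measure (SU N))).prod
          (Measure.pi fun _ : {c : PBond (F.P p.K) (k + 1) // c ∉ (Set.toFinite (bondsIn (k + 1) (s'.Ω (k + 1))ᶜ)).toFinset} =>
            (HaarData.haar : Measure (SU N))))] Fᵢ₀ S₀)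
    (hinner₀ : ∀ᵐ q ∂((Measure.pi fun _ : ↥(Set.toFinite (bondsIn (k + 1) (s'.Ω (k + 1))ᶜ)).toFinset => (HaarData.haar : Measure (SU N))).prod
          (Measure.pi fun _ : {c : PBond (F.P p.K) (k + 1) // c ∉ (Set.toFinite (bondsIn (k + 1) (s'.Ω (k + 1))ᶜ)).toFinset} =>
            (HaarData.haar : Measure (SU N)))),
      ∀ S₀ ∈ admSOfRecord F (rePinH θ).ν (rePinH θ).τ9.M (gOfRecord₁₃ F N (rePinH θ).toStage13Params p) p.K k s'.init, ∀ y : ↥(Set.toFinite (bondsIn k (s'.Ω (k + 1))ᶜ)).toFinset → SU N,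
        avgRestrOfRecord F N p.K k (Set.toFinite (bondsIn k (s'.Ω (k + 1))ᶜ)).toFinset (Set.toFinite (bondsIn (k + 1) (s'.Ω (k + 1))ᶜ)).toFinset y = q.1 →
        Fᵢ₀ S₀ (y, q.2) =
          ∑ Y ∈ (Set.toFinite {Y : Set (Site (F.P p.K) 0) | Y ∈ SClassOfRecord F (rePinH θ).ν (gOfRecord₁₃ F N (rePinH θ).toStage13Params p) p.K (k + 1) ∧ Y ⊆ s'.Ω (k + 1) ∩ (s'.Λ (k + 1))ᶜ}).toFinset,
            zetaOp (genDataOfRecord F N (FluctV N) (rePinH θ).ν (rePinH θ).τ9.M (gOfRecord₁₃ F N (rePinH θ).toStage13Params p) p.K (WtOfRecord₁₃H F N (rePinH θ) p s') s' (Function.update S₀ (k + 1) Y) k).ζ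
              (aOp k (genDataOfRecord F N (FluctV N) (rePinH θ).ν (rePinH θ).τ9.M (gOfRecord₁₃ F N (rePinH θ).toStage13Params p) p.K (WtOfRecord₁₃H F N (rePinH θ) p s') s' (Function.update S₀ (k + 1) Y) k).sA
                (genDataOfRecord F N (FluctV N) (rePinH θ).ν (rePinH θ).τ9.M (gOfRecord₁₃ F N (rePinH θ).toStage13Params p) p.K (WtOfRecord₁₃H F N (rePinH θ) p s') s' (Function.update S₀ (k + 1) Y) k).w
                (tkBranchOfRecord F N (FluctV N) (rePinH θ).ν (rePinH θ).τ9.M (gOfRecord₁₃ F N (rePinH θ).toStage13Params p) p.K (WtOfRecord₁₃H F N (rePinH θ) p s') s'.init S₀ k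
                  (fun ω => (sect2Operand F N (FluctV N) p.K (settingOfRecord₁₃ F N (rePinH θ).toStage13Params p) ((rePinH θ).rzAt p s') s' (graftAboveB k (t s'.init) u) E'
                  (UbgOfRecord₁₃CoP F N (rePinH θ).toStage13Params p (k + 1) s')) (Function.update S₀ (k + 1) Y, fun j => (ω j).2) (fun j => (ω j).1))))
              (Function.update (baseCfg (k + 1) ((MeasurableEquiv.piEquivPiSubtypeProd (fun _ : PBond (F.P p.K) (k + 1) => SU N)
                (· ∈ (Set.toFinite (bondsIn (k + 1) (s'.Ω (k + 1))ᶜ)).toFinset)).symm q)) k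
              (Function.updateFinset ((baseCfg (V := FluctV N) (k + 1) ((MeasurableEquiv.piEquivPiSubtypeProd (fun _ : PBond (F.P p.K) (k + 1) => SU N)
                (· ∈ (Set.toFinite (bondsIn (k + 1) (s'.Ω (k + 1))ᶜ)).toFinset)).symm q)) k).1 (Set.toFinite (bondsIn k (s'.Ω (k + 1))ᶜ)).toFinset y,
                ((baseCfg (V := FluctV N) (k + 1) ((MeasurableEquiv.piEquivPiSubtypeProd (fun _ : PBond (F.P p.K) (k + 1) => SU N)
                (· ∈ (Set.toFinite (bondsIn (k + 1) (s'.Ω (k + 1))ᶜ)).toFinset)).symm q)) k).2))) :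
    slotsTOfRecord F N (rePinH θ).ν (rePinH θ).τ9 (EOfRecord₁₃ F N (rePinH θ).toStage13Params) (wOfRecord₉ F N (rePinH θ).toStage9Params) (rePinH θ).ppSel p (gOfRecord₁₃ F N (rePinH θ).toStage13Params p) (k + 1) s' = 0 ∨
      ∀ᵐ V' ∂fieldMeasure (F.P p.K) (k + 1) (SU N),
        chiSeqOfRecord F N (rePinH θ).ν (rePinH θ).τ9.M (gOfRecord₁₃ F N (rePinH θ).toStage13Params p) p.K (k + 1) s' V' ≠ 0 →
          slotsTOfRecord F N (rePinH θ).ν (rePinH θ).τ9 (EOfRecord₁₃ F N (rePinH θ).toStage13Params) (wOfRecord₉ F N (rePinH θ).toStage9Params) (rePinH θ).ppSel p (gOfRecord₁₃ F N (rePinH θ).toStage13Params p) (k + 1) s' V' =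
            sect2Slot F N (FluctV N) p.K (settingOfRecord₁₃ F N (rePinH θ).toStage13Params p) ((rePinH θ).rzAt p s') (WtOfRecord₁₃H F N (rePinH θ) p s') s' (graftAboveB k (t s'.init) u) E'
              (UbgOfRecord₁₃CoP F N (rePinH θ).toStage13Params p (k + 1) s') V' :=
  slotsTOfRecord₁₃H_succ_O3_of_hasSect2FormAtZS_of_oldBranchInnerSum_rePinH_of_termRows θ h p hkK (hdec := hdec) (hdec' := hdec') hk s' hform
    (graftAboveB k (t s'.init) u) E' htrows₀ (termRowsAt_graftAboveB_all k (t s'.init) u htrows₀ hnew) Fᵢ₀ hFm₀ hin₀ hinner₀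

end Summit.QuantumFields.YangMills.Theorems.BalabanUVNodesN11TStepOldBranchInnerSumAtRePinH

end
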